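import Literature.AlgebraicGeometry.Motives.LinearSubspacesGenerateChow
import Literature.AlgebraicGeometry.Motives.LinesGenerateChowOneProofs
import Literature.AlgebraicGeometry.Motives.CyclesPushforwardProofs
import Literature.AlgebraicGeometry.Motives.SubschemeCyclesFundamentalProofs
import Literature.AlgebraicGeometry.Motives.VarietiesProperProofs
import Mathlib.GroupTheory.SpecificGroups.Cyclic
import HarnessLib

/-!
# Towards Mboro's Cor. 2.9: reduction to irreducible surfaces and the glue of clause (ii)

R. Mboro, *Remarks on the `CH₂` of cubic hypersurfaces*, Geom. Dedicata 200 (2018)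
[Mboro2018] = arXiv:1701.04488. The named fact `Mboro2018_chowTwo_cubic`
(`Motives/LinearSubspacesGenerateChow`) vendors Corollary 6 of the Introduction (p. 4) = Corollary
2.9 (p. 12): for a smooth cubic hypersurface `X ⊂ ℙⁿ⁺¹_k`, `k` algebraically closed of
characteristic `0`, (i) `n ≥ 7 ⇒ CH₂(X)` is generated by classes of planes, (ii) `n ≥ 9 ⇒
CH₂(X) ≃ ℤ`.

The printed proof of (ii) (arXiv text p. 12) is: *"The variety of lines `F(F(X))` of `F(X)` is
isomorphic to the projective bundle `ℙ(ℰ₃|F₂(X))` over `F₂(X)` … Now, when `n ≥ 9`, according to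
[Deb-Man], `CH₀(F₂(X)) ≃ ℤ` so that `CH₀(F(F(X))) ≃ ℤ`"* — i.e. any two planes of `X` have the same
class in `CH₂(X)`; together with (i) the group `CH₂(X)` is cyclic, generated by the class `[Π]` of
a plane, and it is infinite cyclic because `[Π]` has infinite order (its degree is `1`). This file
proves exactly that assembly step, for `r`-planes of any dimension `r` on any embedded `k`-scheme
`i : X ⟶ ℙᴺ_k` (so it serves equally the line case `r = 1`, cf. Tian–Zong's `CH₁(X) ≃ ℤ`,
Compositio 150 (2014) Cor. 1.9, through `chowGeneratedByLinearSubspaces_one_iff`):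

* `nonempty_addEquiv_int_of_closure_eq_top` — an additive group generated by a set all of whose
  members equal one element `g` of infinite order is `≃+ ℤ` (Mathlib's
  `intEquivOfZMultiplesEqTop`);
* `ChowGeneratedByLinearSubspaces.nonempty_addEquiv_int` — Chow level: `CH_r(X)` generated by
  `r`-planes + all `r`-plane classes equal + one `r`-plane class of infinite order ⇒
  `CH_r(X) ≃+ ℤ`;
* `ChowGeneratedByLinearSubspaces.nonempty_addEquiv_int_of_primeCycle` — the same with the two
  geometric inputs phrased on cycles: any two `r`-planes have rationally equivalent prime cycles
  (the Debarre–Manivel / connectedness-of-`F_r(X)` input) and no positive multiple of the prime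
  cycle of some `r`-plane lies in `Rat_r(X)` (the degree input);
* `ChowGeneratedByLinearSubspaces.of_primeCycle`, `chowGeneratedByLinearSubspaces_iff_forall_primeCycle`
  — **reduction to irreducible `r`-folds**: on a compact `X`, `CH_r(X)` is generated by `r`-planes
  as soon as every PRIME `r`-cycle `[closure {z}]` is rationally equivalent to an integral
  combination of `r`-planes (every `r`-cycle is a finite sum of prime cycles,
  `ChowGroup.eq_top_of_forall_ofPoint_mem` of `Motives/LinesGenerateChowOneProofs`; this is the
  opening "let `Γ` be an irreducible surface" of every argument in [Mboro2018] §§1–2);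
* `Mboro2018_chowTwo_cubic_of_primeCycle_inputs` — **the named fact from three cycle-level
  inputs**, the skeleton of the printed proof of Cor. 2.9: (a) for `n ≥ 7` every irreducible
  surface of `X` is rationally equivalent to an integral combination of planes (= (i) on prime
  cycles: Prop. 1.4 + Thm. 2.8), (b) for `n ≥ 9` any two planes of `X` are rationally equivalent
  (Debarre–Manivel), (c) for `n ≥ 9` some plane of `X` is non-torsion modulo rational equivalence
  (degree);
* `IsLinearSubspacePoint.nsmul_primeCycle_notMem_ratTrivial_of_forall_projectiveSpace` — **input
  (c) descends from `ℙᴺ`**: `i_*` preserves prime cycles of planes and rational equivalence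
  (Fulton Thm. 1.4, the tree's proved `map_mem_ratTrivial_holds`), so (c) reduces to the existence
  of a plane on `X` plus "`m • [Λ] ∉ Rat_r(ℙᴺ)` for `m > 0`" on projective space (Fulton §1.9).

## What is NOT here

The discharge `Mboro2018_chowTwo_cubic_holds`, i.e. the inputs (a)–(c) themselves. Clause (i)
is Prop. 1.4 (surjectivity of the universal-line correspondence `P_* : CH₁(F₁(X)) → CH₂(X)`, via
osculating lines, Tsen–Lang and resolution of singularities) composed with Thm. 2.8 (`CH₁(F₁(X))`
generated by lines: bend-and-break, Tian–Zong's theorem on separably rationally connected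
varieties, Kollár, divisibility of `CH₁(F₁(X))_alg`), and the two inputs of (ii) are
Debarre–Manivel (`CH₀(F₂(X)) ≃ ℤ`, `n ≥ 9`) and a degree map on `CH₂(X)`. The tree has proper
push-forward and flat pull-back on Chow groups (Fulton Thm. 1.4 / 1.7, the named facts
`map_mem_ratTrivial`, `flatPullback_mem_ratTrivial_of_finiteType`, both discharged:
`Motives/CyclesPushforwardProofs`, `Motives/SubschemeCyclesRatFiniteTypeHoldsProofs`), hence the
span action `q_* p^*` (`Motives/CorrespondenceChowAction`), the class of a Cartier divisor
(`Motives/CartierDivisorChowClass`) and the Fano schemes `F_r(X)` as subschemes of the Plücker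
space (`Motives/FanoSchemeOfPlanes`); it does not yet have intersection with divisors `D · [V]`
(Fulton Ch. 2) or a degree on `CH₂`, the universal families `P_r → F_r(X)` as flat projective
bundles, the dimension / smoothness / connectedness of `F₁(X)`, `F₂(X)` (Altman–Kleiman,
Barth–Van de Ven, Debarre–Manivel), Chern classes with values in Chow groups (only the
cohomological axiomatics of `Motives/ChernClasses`), rational (chain) connectedness and the
theorems of Kollár and Tian–Zong, Tsen–Lang, or resolution of singularities.

## References

* [Mboro2018] R. Mboro, *Remarks on the `CH₂` of cubic hypersurfaces*, Geom. Dedicata 200 (2018);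
  arXiv:1701.04488, Cor. 6 (p. 4) = Cor. 2.9 (p. 12) and its proof.
* O. Debarre, L. Manivel, *Sur la variété des espaces linéaires contenus dans une intersection
  complète*, Math. Ann. 312 (1998). [DebarreManivel1998]
* W. Fulton, *Intersection Theory*, §1.3. [Fulton1998]
-/

noncomputable section

open CategoryTheory AlgebraicGeometry

universe u

namespace Literature.AlgebraicGeometry.Motives

/-! ### The abstract group-theoretic step -/

/-- An additive group generated by a set `S` all of whose members are equal to a single element `g`
of infinite order is infinite cyclic: `G ≃+ ℤ` (with `g ↦ 1`). This is the group theory behind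
"`CH₂(X)` is generated by planes, all planes have the same class, and that class has degree `1`,
hence `CH₂(X) ≃ ℤ`" in the proof of [Mboro2018] Cor. 2.9 (ii). [folklore] -/
theorem nonempty_addEquiv_int_of_closure_eq_top {G : Type*} [AddGroup G] {S : Set G} {g : G}
    (hS : AddSubgroup.closure S = ⊤) (hg : ∀ x ∈ S, x = g) (hord : ¬IsOfFinAddOrder g) :
    Nonempty (G ≃+ ℤ) := by
  have htop : AddSubgroup.zmultiples g = ⊤ := by
    rw [eq_top_iff, ← hS]
    refine (AddSubgroup.closure_le _).mpr fun x hx => ?_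
    rw [SetLike.mem_coe, hg x hx]
    exact AddSubgroup.mem_zmultiples g
  haveI : Infinite G :=
    Infinite.of_injective (fun n : ℤ => n • g) (injective_zsmul_iff_not_isOfFinAddOrder.mpr hord)
  exact ⟨(intEquivOfZMultiplesEqTop g htop).symm⟩

/-- `ℤ` is torsion-free: under any `G ≃+ ℤ` a nonzero element has infinite order. (The cheap
converse of the previous lemma's order hypothesis.) [folklore] -/
theorem not_isOfFinAddOrder_of_addEquiv_int {G : Type*} [AddGroup G] (e : G ≃+ ℤ) {x : G}
    (hx : x ≠ 0) : ¬IsOfFinAddOrder x := by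
  intro hfin
  have hfin' : IsOfFinAddOrder (e x) := e.toAddMonoidHom.isOfFinAddOrder hfin
  have hex : e x ≠ 0 := by simpa using hx
  obtain ⟨m, hm, hm0⟩ := isOfFinAddOrder_iff_nsmul_eq_zero.mp hfin'
  rw [nsmul_eq_mul, mul_eq_zero] at hm0
  rcases hm0 with hm0 | hm0
  · exact (Nat.cast_ne_zero.mpr hm.ne') hm0
  · exact hex hm0

/-! ### Chow level -/

section Chow

variable {k : Type u} [Field k] {r N : ℕ} {X : SchemeOver k} {i : X ⟶ projectiveSpace N k}

/-- Rationally equivalent prime cycles of two `r`-dimensional points have the same class in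
`CH_r(X)` (Fulton §1.3; `ChowGroup.mk_eq_mk_iff`). [folklore] -/
theorem ChowGroup.ofPoint_eq_ofPoint_of_isRationallyEquivalent {Y : Scheme.{u}} {z z' : ↥Y}
    (hz : Order.height z = r) (hz' : Order.height z' = r)
    (hrat : IsRationallyEquivalent (primeCycle z) (primeCycle z') r) :
    ChowGroup.ofPoint z hz = ChowGroup.ofPoint z' hz' :=
  ChowGroup.mk_eq_mk_iff.mpr hrat

/-- Conversely, two `r`-dimensional points with the same class in `CH_r(X)` have rationally
equivalent prime cycles. [folklore] -/
theorem ChowGroup.isRationallyEquivalent_of_ofPoint_eq {Y : Scheme.{u}} {z z' : ↥Y}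
    (hz : Order.height z = r) (hz' : Order.height z' = r)
    (h : ChowGroup.ofPoint z hz = ChowGroup.ofPoint z' hz') :
    IsRationallyEquivalent (primeCycle z) (primeCycle z') r :=
  ChowGroup.mk_eq_mk_iff.mp h

/-- The class `[V] ∈ CH_r(X)` of an `r`-dimensional point `z` has infinite order as soon as no
positive multiple `m • [closure {z}]` of its prime cycle is rationally equivalent to zero (for a
plane of a projective variety this is the degree: `deg (m • Π) = m ≠ 0`). [folklore] -/
theorem ChowGroup.not_isOfFinAddOrder_ofPoint {Y : Scheme.{u}} {z : ↥Y} (hz : Order.height z = r)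
    (htors : ∀ m : ℕ, 0 < m → m • primeCycle z ∉ ratTrivial Y r) :
    ¬IsOfFinAddOrder (ChowGroup.ofPoint z hz) := by
  rw [isOfFinAddOrder_iff_nsmul_eq_zero]
  rintro ⟨m, hm, hm0⟩
  refine htors m hm ?_
  simp only [ChowGroup.ofPoint, ← map_nsmul, ChowGroup.mk_eq_zero_iff] at hm0
  simpa using hm0

/-- Conversely, if the class of `z` has infinite order then no positive multiple of its prime
cycle is rationally equivalent to zero. [folklore] -/
theorem ChowGroup.nsmul_primeCycle_notMem_ratTrivial {Y : Scheme.{u}} {z : ↥Y}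
    (hz : Order.height z = r) (h : ¬IsOfFinAddOrder (ChowGroup.ofPoint z hz)) {m : ℕ}
    (hm : 0 < m) : m • primeCycle z ∉ ratTrivial Y r := by
  intro hmem
  refine h (isOfFinAddOrder_iff_nsmul_eq_zero.mpr ⟨m, hm, ?_⟩)
  simp only [ChowGroup.ofPoint, ← map_nsmul, ChowGroup.mk_eq_zero_iff]
  simpa using hmem

/-- **Glue of [Mboro2018] Cor. 2.9 (ii), Chow level.** If `CH_r(X)` is generated by the `r`-planes
of `X ⊆ ℙᴺ` (`ChowGeneratedByLinearSubspaces r N i`, clause (i) of Cor. 2.9 for `r = 2`), all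
`r`-plane classes coincide (for planes on a cubic of dimension `≥ 9`: `CH₀(F₂(X)) ≃ ℤ`,
Debarre–Manivel, as used on p. 12 of arXiv:1701.04488), and some `r`-plane class has infinite
order (degree), then `CH_r(X) ≃ ℤ`. [cite: Mboro2018, Cor. 2.9 (ii), proof (arXiv:1701.04488 p. 12)] -/
theorem ChowGeneratedByLinearSubspaces.nonempty_addEquiv_int
    (h : ChowGeneratedByLinearSubspaces r N i)
    (heq : ∀ x ∈ linearSubspaceClasses r N i, ∀ y ∈ linearSubspaceClasses r N i, x = y)
    (hinf : ∃ x ∈ linearSubspaceClasses r N i, ¬IsOfFinAddOrder x) :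
    Nonempty (ChowGroup X.left r ≃+ ℤ) := by
  obtain ⟨g, hgS, hg⟩ := hinf
  exact nonempty_addEquiv_int_of_closure_eq_top h.closure_eq_top (fun x hx => heq x hx g hgS) hg

/-- **Glue of [Mboro2018] Cor. 2.9 (ii), cycle level.** If every `r`-cycle on `X` is rationally
equivalent to an integral combination of `r`-planes of `X ⊆ ℙᴺ`, any two `r`-planes of `X` have
rationally equivalent prime cycles, and for some `r`-plane `z₀` no positive multiple of
`[closure {z₀}]` lies in `Rat_r(X)`, then `CH_r(X) ≃ ℤ`. For `r = 2`, `N = n + 1`, `X` a smooth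
cubic `n`-fold with `n ≥ 9` the three hypotheses are Cor. 2.9 (i), Debarre–Manivel's
`CH₀(F₂(X)) ≃ ℤ` pushed forward to `X`, and `deg [Π] = 1`; the conclusion is Cor. 2.9 (ii).
[cite: Mboro2018, Cor. 2.9 (ii), proof (arXiv:1701.04488 p. 12)] -/
theorem ChowGeneratedByLinearSubspaces.nonempty_addEquiv_int_of_primeCycle
    (h : ChowGeneratedByLinearSubspaces r N i)
    (heq : ∀ ⦃z z' : ↥X.left⦄, IsLinearSubspacePoint r N i z → IsLinearSubspacePoint r N i z' →
      IsRationallyEquivalent (primeCycle z) (primeCycle z') r)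
    {z₀ : ↥X.left} (hz₀ : IsLinearSubspacePoint r N i z₀)
    (htors : ∀ m : ℕ, 0 < m → m • primeCycle z₀ ∉ ratTrivial X.left r) :
    Nonempty (ChowGroup X.left r ≃+ ℤ) := by
  refine h.nonempty_addEquiv_int ?_ ⟨_, ofPoint_mem_linearSubspaceClasses hz₀,
    ChowGroup.not_isOfFinAddOrder_ofPoint hz₀.height_eq htors⟩
  rintro x ⟨z, hz, rfl⟩ y ⟨z', hz', rfl⟩
  exact ChowGroup.ofPoint_eq_ofPoint_of_isRationallyEquivalent _ _ (heq hz hz')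

/-- **What (ii) gives back.** If `CH_r(X) ≃ ℤ` then every `r`-plane whose class is nonzero has a
class of infinite order, i.e. no positive multiple of its prime cycle is rationally equivalent to
zero. [folklore] -/
theorem nsmul_primeCycle_notMem_ratTrivial_of_addEquiv_int (e : ChowGroup X.left r ≃+ ℤ)
    {z : ↥X.left} (hz : IsLinearSubspacePoint r N i z)
    (hne : ChowGroup.ofPoint z hz.height_eq ≠ 0) {m : ℕ} (hm : 0 < m) :
    m • primeCycle z ∉ ratTrivial X.left r :=
  ChowGroup.nsmul_primeCycle_notMem_ratTrivial hz.height_eq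
    (not_isOfFinAddOrder_of_addEquiv_int e hne) hm

end Chow

/-! ### Reduction of "`CH_r(X)` is generated by `r`-planes" to prime cycles -/

section PrimeCycles

variable {k : Type u} [Field k] {r N : ℕ} {X : SchemeOver k} {i : X ⟶ projectiveSpace N k}

/-- Chow-group form of the reduction: on a compact `X`, a subgroup of `CH_r(X)` containing the
class of every `r`-dimensional `closure {z}` is everything (every `r`-cycle is a finite integral
combination of prime cycles, Fulton §1.3). [cite: Fulton1998, §1.3] -/
theorem closure_linearSubspaceClasses_eq_top_of_forall_ofPoint_mem [CompactSpace ↥X.left]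
    (h : ∀ (z : ↥X.left) (hz : Order.height z = r),
      ChowGroup.ofPoint z hz ∈ AddSubgroup.closure (linearSubspaceClasses r N i)) :
    AddSubgroup.closure (linearSubspaceClasses r N i) = ⊤ :=
  ChowGroup.eq_top_of_forall_ofPoint_mem h

/-- **Reduction to irreducible `r`-folds** (the opening move "let `Γ ⊆ X` be an irreducible
surface" of the arguments of [Mboro2018] §§1–2, e.g. the proof of Thm. 1.3): on a compact embedded
`k`-scheme `i : X ⟶ ℙᴺ`, if every prime `r`-cycle `[closure {z}]` (`dim closure {z} = r`) is
rationally equivalent, as an `r`-cycle, to an integral combination of prime cycles of `r`-planes,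
then `CH_r(X)` is generated by `r`-planes (`ChowGeneratedByLinearSubspaces r N i`).
[cite: Mboro2018, §1, proof of Thm. 1.3 (arXiv:1701.04488 p. 7)] -/
theorem ChowGeneratedByLinearSubspaces.of_primeCycle [CompactSpace ↥X.left]
    (h : ∀ z : ↥X.left, Order.height z = r → ∃ (s : Finset ↥X.left) (w : ↥X.left → ℤ),
      (∀ y ∈ s, IsLinearSubspacePoint r N i y) ∧
        IsRationallyEquivalent (primeCycle z) (∑ y ∈ s, w y • primeCycle y) r) :
    ChowGeneratedByLinearSubspaces r N i := by
  refine chowGeneratedByLinearSubspaces_of_closure_eq_top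
    (closure_linearSubspaceClasses_eq_top_of_forall_ofPoint_mem fun z hz ↦ ?_)
  obtain ⟨s, w, hs, hrat⟩ := h z hz
  have hmk : ChowGroup.ofPoint z hz = ChowGroup.mk X.left r
      ⟨_, sum_zsmul_primeCycle_mem_cyclesOfDim_of_isLinearSubspacePoint w hs⟩ :=
    ChowGroup.mk_eq_mk_iff.mpr hrat
  rw [hmk]
  exact mk_sum_zsmul_primeCycle_mem_closure_linearSubspaceClasses w hs

/-- Conversely, generation by `r`-planes specialised to a prime `r`-cycle. [folklore] -/
theorem ChowGeneratedByLinearSubspaces.exists_of_height_eq (h : ChowGeneratedByLinearSubspaces r N i)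
    {z : ↥X.left} (hz : Order.height z = r) :
    ∃ (s : Finset ↥X.left) (w : ↥X.left → ℤ), (∀ y ∈ s, IsLinearSubspacePoint r N i y) ∧
      IsRationallyEquivalent (primeCycle z) (∑ y ∈ s, w y • primeCycle y) r :=
  h _ (primeCycle_mem_cyclesOfDim hz)

/-- On a compact embedded `k`-scheme, `CH_r(X)` is generated by `r`-planes iff every prime
`r`-cycle is rationally equivalent to an integral combination of `r`-planes.
[cite: Mboro2018, §1, proof of Thm. 1.3 (arXiv:1701.04488 p. 7)] -/
theorem chowGeneratedByLinearSubspaces_iff_forall_primeCycle [CompactSpace ↥X.left] :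
    ChowGeneratedByLinearSubspaces r N i ↔
      ∀ z : ↥X.left, Order.height z = r → ∃ (s : Finset ↥X.left) (w : ↥X.left → ℤ),
        (∀ y ∈ s, IsLinearSubspacePoint r N i y) ∧
          IsRationallyEquivalent (primeCycle z) (∑ y ∈ s, w y • primeCycle y) r :=
  ⟨fun h _ hz ↦ h.exists_of_height_eq hz, ChowGeneratedByLinearSubspaces.of_primeCycle⟩

end PrimeCycles

/-! ### The named fact from its three cycle-level inputs -/

section Skeleton

/-- **[Mboro2018] Cor. 2.9 from three cycle-level inputs** — the skeleton of the printed proof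
(arXiv:1701.04488 p. 12) on the tree's carriers, for smooth cubic hypersurfaces `X ⊆ ℙⁿ⁺¹_k`
spelled exactly as in `Mboro2018_chowTwo_cubic`:
(a) (`n ≥ 7`; = clause (i) on irreducible surfaces, in print Prop. 1.4 + Thm. 2.8) every prime
`2`-cycle of `X` is rationally equivalent to an integral combination of prime cycles of planes;
(b) (`n ≥ 9`; in print Debarre–Manivel's `CH₀(F₂(X)) ≃ ℤ` via `F(F(X)) ≅ ℙ(ℰ₃|F₂(X))`) any two
planes of `X` have rationally equivalent prime cycles;
(c) (`n ≥ 9`; existence of planes and `deg [Π] = 1`) `X` contains a plane no positive multiple of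
whose prime cycle lies in `Rat₂(X)`.
Then the named fact holds: (i) by the reduction to prime cycles (a smooth projective variety is
compact, `IsSmoothProjective.compactSpace_holds`), (ii) by
`ChowGeneratedByLinearSubspaces.nonempty_addEquiv_int_of_primeCycle`. The inputs (a)–(c) are NOT
proved here. [cite: Mboro2018, Cor. 2.9 and its proof (arXiv:1701.04488 p. 12)] -/
theorem Mboro2018_chowTwo_cubic_of_primeCycle_inputs
    (ha : ∀ ⦃k : Type u⦄ [Field k] [IsAlgClosed k] [CharZero k] (n : ℕ) ⦃X : SchemeOver k⦄
      (F : MvPolynomial (Fin (n + 1 + 1)) k) (i : X ⟶ projectiveSpace (n + 1) k),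
      letI := MvPolynomial.gradedAlgebra (σ := Fin (n + 1 + 1)) (R := k)
      IsSmoothProjective n X → F.IsHomogeneous 3 → Irreducible F → IsClosedImmersion i.left →
        Set.range i.left.base =
          ProjectiveSpectrum.zeroLocus (MvPolynomial.homogeneousSubmodule (Fin (n + 1 + 1)) k)
            {F} →
          7 ≤ n → ∀ z : ↥X.left, Order.height z = 2 →
            ∃ (s : Finset ↥X.left) (w : ↥X.left → ℤ),
              (∀ y ∈ s, IsLinearSubspacePoint 2 (n + 1) i y) ∧
                IsRationallyEquivalent (primeCycle z) (∑ y ∈ s, w y • primeCycle y) 2)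
    (hb : ∀ ⦃k : Type u⦄ [Field k] [IsAlgClosed k] [CharZero k] (n : ℕ) ⦃X : SchemeOver k⦄
      (F : MvPolynomial (Fin (n + 1 + 1)) k) (i : X ⟶ projectiveSpace (n + 1) k),
      letI := MvPolynomial.gradedAlgebra (σ := Fin (n + 1 + 1)) (R := k)
      IsSmoothProjective n X → F.IsHomogeneous 3 → Irreducible F → IsClosedImmersion i.left →
        Set.range i.left.base =
          ProjectiveSpectrum.zeroLocus (MvPolynomial.homogeneousSubmodule (Fin (n + 1 + 1)) k)
            {F} →
          9 ≤ n → ∀ ⦃z z' : ↥X.left⦄, IsLinearSubspacePoint 2 (n + 1) i z →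
            IsLinearSubspacePoint 2 (n + 1) i z' →
              IsRationallyEquivalent (primeCycle z) (primeCycle z') 2)
    (hc : ∀ ⦃k : Type u⦄ [Field k] [IsAlgClosed k] [CharZero k] (n : ℕ) ⦃X : SchemeOver k⦄
      (F : MvPolynomial (Fin (n + 1 + 1)) k) (i : X ⟶ projectiveSpace (n + 1) k),
      letI := MvPolynomial.gradedAlgebra (σ := Fin (n + 1 + 1)) (R := k)
      IsSmoothProjective n X → F.IsHomogeneous 3 → Irreducible F → IsClosedImmersion i.left →
        Set.range i.left.base =
          ProjectiveSpectrum.zeroLocus (MvPolynomial.homogeneousSubmodule (Fin (n + 1 + 1)) k)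
            {F} →
          9 ≤ n → ∃ z₀ : ↥X.left, IsLinearSubspacePoint 2 (n + 1) i z₀ ∧
            ∀ m : ℕ, 0 < m → m • primeCycle z₀ ∉ ratTrivial X.left 2) :
    Mboro2018_chowTwo_cubic.{u} := by
  intro k _ _ _ n X F i hX hF hirr hi hV
  haveI : CompactSpace ↥X.left := IsSmoothProjective.compactSpace_holds hX
  refine ⟨fun hn => ChowGeneratedByLinearSubspaces.of_primeCycle (ha n F i hX hF hirr hi hV hn),
    fun hn => ?_⟩
  obtain ⟨z₀, hz₀, htors⟩ := hc n F i hX hF hirr hi hV hn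
  exact (ChowGeneratedByLinearSubspaces.of_primeCycle
    (ha n F i hX hF hirr hi hV (le_trans (by norm_num) hn))).nonempty_addEquiv_int_of_primeCycle
      (hb n F i hX hF hirr hi hV hn) hz₀ htors

end Skeleton

/-! ### Input (c) descends from the ambient projective space -/

section Pushforward

variable {k : Type u} [Field k] {r : ℕ} {X Y : SchemeOver k}

/-- **Non-torsion descends along a closed immersion** `f : X ↪ Y` (`Y` locally of finite type
over `k`): if no positive multiple of `[closure {f z}]` lies in `Rat_r(Y)` then no positive
multiple of `[closure {z}]` lies in `Rat_r(X)` — `f_*` preserves rational equivalence (Fulton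
Thm. 1.4 = Stacks 02S2, the tree's proved `map_mem_ratTrivial_holds`) and
`f_* [closure {z}] = [closure {f z}]` (`algebraicCycleMap_primeCycle`, Fulton §1.5).
[cite: Fulton1998, Thm. 1.4 and §1.5] -/
theorem nsmul_primeCycle_notMem_ratTrivial_of_isClosedImmersion (f : X ⟶ Y)
    [IsClosedImmersion f.left] [LocallyOfFiniteType Y.hom] {z : ↥X.left}
    (h : ∀ m : ℕ, 0 < m → m • primeCycle (f.left.base z) ∉ ratTrivial Y.left r) {m : ℕ}
    (hm : 0 < m) : m • primeCycle z ∉ ratTrivial X.left r := by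
  intro hmem
  haveI : LocallyOfFiniteType X.hom := by rw [← Over.w f]; infer_instance
  have hmap := map_mem_ratTrivial_holds (d := r) (k := k) f hmem
  have hn : ∀ n : ℕ, AlgebraicCycle.map f.left Order.height Order.height (n • primeCycle z) =
      n • primeCycle (f.left.base z) := by
    intro n
    induction n with
    | zero => rw [zero_smul, zero_smul, algebraicCycleMap_zero]
    | succ n ih =>
      rw [succ_nsmul, succ_nsmul, algebraicCycleMap_add, ih, algebraicCycleMap_primeCycle]
  rw [hn] at hmap
  exact h m hm hmap

variable {N : ℕ} {i : X ⟶ projectiveSpace N k}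

/-- **An `r`-plane of `X ⊆ ℙᴺ` is an `r`-plane of `ℙᴺ`** (for the identity embedding): a closed
immersion preserves the dimension of point closures (`height_base_eq_of_isClosedImmersion'`) and
`closure {i z} = i '' closure {z}`. [folklore] -/
theorem IsLinearSubspacePoint.base_of_isClosedImmersion [IsClosedImmersion i.left] {z : ↥X.left}
    (hz : IsLinearSubspacePoint r N i z) :
    IsLinearSubspacePoint r N (𝟙 (projectiveSpace N k)) (i.left.base z) := by
  refine ⟨?_, ?_⟩
  · rw [height_base_eq_of_isClosedImmersion' i.left z]
    exact hz.height_eq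
  · obtain ⟨L, hL, hhom, himg⟩ := hz.2
    refine ⟨L, hL, hhom, ?_⟩
    have hid : ⇑(𝟙 (projectiveSpace N k) : projectiveSpace N k ⟶ projectiveSpace N k).left.base =
        id := by
      funext x; rfl
    rw [hid, Set.image_id, ← himg, ← Set.image_singleton,
      i.left.isClosedEmbedding.closure_image_eq]

/-- The case `Y = ℙᴺ_k` (proper over `k`, `isProper_projectiveSpace`): if no positive multiple of
`[closure {i z₀}]` lies in `Rat_r(ℙᴺ)` (for an `r`-plane: `[Λ] ∈ CH_r(ℙᴺ) ≅ ℤ` has infinite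
order, Fulton §1.9) then no positive multiple of `[closure {z₀}]` lies in `Rat_r(X)`.
[cite: Fulton1998, Thm. 1.4 and §1.9] -/
theorem IsLinearSubspacePoint.nsmul_primeCycle_notMem_ratTrivial_of_projectiveSpace
    [IsClosedImmersion i.left] {z₀ : ↥X.left}
    (h : ∀ m : ℕ, 0 < m →
      m • primeCycle (i.left.base z₀) ∉ ratTrivial (projectiveSpace N k).left r)
    {m : ℕ} (hm : 0 < m) : m • primeCycle z₀ ∉ ratTrivial X.left r := by
  haveI := isProper_projectiveSpace (n := N) (k := k)
  exact nsmul_primeCycle_notMem_ratTrivial_of_isClosedImmersion i h hm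

/-- **Input (c) of `Mboro2018_chowTwo_cubic_of_primeCycle_inputs` from projective space**: if
every `r`-plane of `ℙᴺ_k` is non-torsion modulo rational equivalence on `ℙᴺ` (Fulton §1.9) then
every `r`-plane point of a closed subscheme `X ⊆ ℙᴺ` is a non-torsion `r`-plane of `X`.
[cite: Fulton1998, Thm. 1.4 and §1.9] -/
theorem IsLinearSubspacePoint.nsmul_primeCycle_notMem_ratTrivial_of_forall_projectiveSpace
    [IsClosedImmersion i.left]
    (hP : ∀ w : ↥(projectiveSpace N k).left, IsLinearSubspacePoint r N (𝟙 (projectiveSpace N k)) w →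
      ∀ m : ℕ, 0 < m → m • primeCycle w ∉ ratTrivial (projectiveSpace N k).left r)
    {z₀ : ↥X.left} (hz₀ : IsLinearSubspacePoint r N i z₀) {m : ℕ} (hm : 0 < m) :
    m • primeCycle z₀ ∉ ratTrivial X.left r :=
  IsLinearSubspacePoint.nsmul_primeCycle_notMem_ratTrivial_of_projectiveSpace
    (hP _ hz₀.base_of_isClosedImmersion) hm

end Pushforward

end Literature.AlgebraicGeometry.Motives

end
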